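import Summits.BirchSwinnertonDyer.BirchSwinnertonDyer.Theorems.PrintX9HowardIMCLink
import Summits.BirchSwinnertonDyer.BirchSwinnertonDyer.Theorems.PrintX9HeegnerRankOnePair
import Summits.BirchSwinnertonDyer.BirchSwinnertonDyer.Theorems.Rank1ResidualX9CMPartner
import Summits.BirchSwinnertonDyer.BirchSwinnertonDyer.Theorems.Rank1ResidualX9MuTransfer
import HarnessLib

/-!
# Class X9, the HOWARD ROAD to the leaf (J-free): rank one at EVERY Tamagawa depth from
# Mastella–Zerman 2026 Cor. 4.6 ∘ the Yan–Zhu/BCS/CGLS composite ∘ JSW 2017 Thm. 3.3.1, the K6 typed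
# rank-`0` engine at the twist, and ONE new binder — a Heegner FRAME with `p ∤ h_K`
# (cell `bsd-print-x9`, prover seat p4 «Heegner/Kolyvagin road under irreducibility», gen 3;
# companion of `PrintX9HowardIMCLink.lean`)

HONEST FRAMING (cell `run/shared/lean/pub/bsd-print-x9/`, D-0131 print tier): THEOREMS ONLY (no
definition, no named fact, no `sorry`); every published theorem enters as one of the tree's named
Literature facts BY NAME; every unproved statement is an EXPLICIT binder — here the K6 typed rank-`0`
engine `IntegralMainConjectureOnClassX9` (= `KatoMuTransfer ∧ AnalyticMuZeroOnClassX9`, route items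
19629/19630, OPEN) and the FRAME SUPPLY `hFS` (below). Nothing about any particular curve is asserted;
no label changes; the leaf `BSDpOnClassX9` is NOT closed (currency: crux-record / conditional bridge).

## What this file proves

Route `PrintX9`'s landed assembly reads `HeegnerDivisibilityX9 (J) → MuTransfer → AnalyticMuZeroX9 →
print → BSDpOnClassX9` (p4 g0, `PrintX9HeegnerDivisibility.lean`); after p4 g2's Jetchev chain the
open reading of J is the multi-carrier regime `MultiPrimeX9` (no printed source at any image). The
companion `PrintX9HowardIMCLink.lean` proved the Heegner-index identity over `K` WITHOUT J from
Howard's divisibility at non-surjective image (Mastella–Zerman 2026 Cor. 4.6, scalars = Lombardo–Tronto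
theorem) + the image-free transfer (Yan–Zhu 2026 5.7 (1)/5.9 + BCS 4.2.2 + CGLS 5.1.3, composite
p563407) + JSW 3.3.1, at the price of ONE frame binder `p ∤ h_K` (Howard 2004 §3 / MZ26 Assumption 2.1 /
Yan–Zhu `Thm57Hypotheses`). Here:

* §1 `X9.bsdp_rankOne_of_howardFrame_of_x9IntegralMainConjecture` — `BSD(E,p)` at a rank-one X9
  pair GIVEN a Heegner field `K` with `p` split, `d_K` odd `< −4`, `L(E^{d_K},1) ≠ 0` AND `p ∤ h_K`:
  the identity over `K` (companion §3) + the twist's rank-`0` `p`-part from the K6 engine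
  (`classX9_twist_model`, `mazurMainConjecture_of_integralMainConjectureOnClassX9`) + the descent
  `X11b.bsdp_rankOne_of_indexIdentityAt_of_twist_mazurMainConjecture`. NO Kolyvagin structure bound,
  NO Cha, NO Jetchev, NO (sur)/(im), ANY Tamagawa numbers.
* §2 `bsdpOnClassX9_of_heegnerFrameSupply_of_cor46_of_integralMainConjectureOnClassX9` and
  `…_of_katoMuTransfer` — the LEAF `BSDpOnClassX9` from PUBLISHED facts ∧ the K6 engine (resp. the
  route items 19629/19630) ∧ the FRAME SUPPLY
  `hFS`: «every rank-one X9 pair has a Heegner field `K` (imaginary quadratic, `d_K` odd `< −4`, every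
  `ℓ ∣ N_E` and `p` split) with `p ∤ h_K` and `L(E^{d_K}, 1) ≠ 0`» — Hoffstein–Luo's non-vanishing
  twist WITH the class-number condition. This is the J-FREE assembly of the X9 Heegner road: compared
  with `bsdpOnClassX9_of_heegnerDivisibilityX9_of_katoMuTransfer` it trades the crux J (after g2: the
  multi-carrier regime `MultiPrimeX9`, no print at any image, not per-pair certifiable) for `hFS`
  (an analytic frame-supply statement; per pair a FINITE certificate — lit DOSSIER §33: a frame with
  `p ∤ h(D)` is on disk for 129/135 live pairs — and class-wide a Kohnen–Ono-type question).

«beyond-print theorem»: NO — composite of print read at the X9 image; the new residual is NAMED (`hFS`).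

References: [MastellaZerman2026] Cor. 4.6; [YanZhu2024MainConjNonCM] Thm. 5.7 (1), 5.9;
[BurungaleCastellaSkinner2025] Prop. 4.2.2, Thm. 4.2.1, Cor. 1.3.1 (proof p. 4);
[CastellaGrossiLeeSkinner2022] Thm. 5.1.3; [JetchevSkinnerWan2017] Thm. 3.3.1, §7.4.1;
[Howard2004HeegnerKolyvagin] Thm. B, §3; [HoffsteinLuo1997] Theorem; [GreenbergLNM1716] Thm. 4.1;
[Kato2004Asterisque] Thm. 12.5, 17.4; route file `Theses/PrintX9.lean` (rev 3).
-/

set_option linter.dupNamespace false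
set_option autoImplicit false

noncomputable section

open scoped Classical MatrixGroups ModularForm

open CongruenceSubgroup WeierstrassCurve NumberField IsDedekindDomain
  Literature.NumberTheory.EllipticCurves Literature.NumberTheory.EllipticCurves.ModularForms
  Literature.NumberTheory.EllipticCurves.BurungaleCastellaSkinner2025
  Literature.NumberTheory.EllipticCurves.JetchevSkinnerWan2017
  Literature.NumberTheory.EllipticCurves.YanZhu2026
  Summit.BirchSwinnertonDyer.BirchSwinnertonDyer.Theorems.Rank1ResidualX1Defs
  Summit.BirchSwinnertonDyer.Rank1Residual

open Literature.NumberTheory.EllipticCurves.Rank1Residual (GoodOrd Irr Surj BigIm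
  norm_periodRatio_eq_one pPart_of_bsdp not_dvd_discr_of_split)

namespace Summit.BirchSwinnertonDyer.BirchSwinnertonDyer.Rank1Residual

/-! ### §1 Rank one at an X9 pair on a Howard frame (`p ∤ h_K`) — any Tamagawa depth, no J -/

/-- **Rank one on class X9 at the pair, ANY Tamagawa numbers, NO Heegner-point divisibility, GIVEN a
Heegner frame with `p ∤ h_K`** — for `W` of class X9 at `p` with `ord_{s=1} L(E,s) = 1` and an imaginary
quadratic `K` with `d_K` odd `< −4`, every `ℓ ∣ N_E` and `p` split, `L(E^{d_K},1) ≠ 0` and `p ∤ h_K`: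
`BSD(E,p)`. Chain: Manin-unit Heegner datum at the good prime `p` (Mazur, `exists_maninDatum_of_good`);
the Heegner-index IDENTITY over `K` from Mastella–Zerman Cor. 4.6 (`h46`) + the Yan–Zhu/BCS/CGLS
composite (`hYZ`) + JSW 3.3.1 (`h331`) (`X9.indexIdentityAt_of_heegner_of_cor46_of_thm331`); a
globally minimal model of the twist (Néron), of class X9 again (`classX9_twist_model`), its rank-`0`
`p`-part from the K6 engine read as Mazur's main conjecture
(`mazurMainConjecture_of_integralMainConjectureOnClassX9`); descent
`X11b.bsdp_rankOne_of_indexIdentityAt_of_twist_mazurMainConjecture`. `w_K = 2` from `d_K < −4`.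
NO Schneider, NO (im), NO (sur), NO Tamagawa restriction, NO crux J.
[cite: MastellaZerman2026, Cor. 4.6] [cite: YanZhu2024MainConjNonCM, Thm. 5.7 (1), Thm. 5.9]
[cite: BurungaleCastellaSkinner2025, Prop. 4.2.2, Cor. 1.3.1 (proof, p. 4)]
[cite: CastellaGrossiLeeSkinner2022, Thm. 5.1.3] [cite: JetchevSkinnerWan2017, Thm. 3.3.1, §7.4.1]
[cite: GreenbergLNM1716, Thm. 4.1] [cite: Mazur1978, Cor. 4.1] [cite: Miller2011LMS, Def. 1.1] -/
theorem X9.bsdp_rankOne_of_howardFrame_of_x9IntegralMainConjecture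
    -- published inputs (named facts of the tree)
    (h46 : MastellaZerman2026.cor46_howardDivisibility_of_scalarImage.{0})
    (hYZ : thm57_thm59_bcs422_cgls513_generator_constantCoeff_of_heegnerDivisibility)
    (h331 : thm331_anticyclotomicControl)
    (hGZ : ∀ (N : ℕ) [NeZero N] (W : WeierstrassCurve ℚ) (K : Type) [Field K] [NumberField K],
      gross_zagier N W K)
    (hKo : ∀ (N : ℕ) [NeZero N] (W : WeierstrassCurve ℚ) (K : Type) [Field K] [NumberField K],
      kolyvagin N W K)
    (hGr : greenberg_charValue_rankZero) (hGZK : rank_eq_analyticRank_of_analyticRank_le_one)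
    (hmod : hasEntireLFunction_rat) (hpar : nonempty_modularParametrizationData)
    (hnf : exists_isNewformOf)
    (hMaz : mazur_not_dvd_maninConstant_of_odd) (hNS : integral_neronScaling_of_isGloballyMinimal)
    (h5 : realPeriodRat_eq_unit_mul_plusPeriod)
    -- the pair
    (W : WeierstrassCurve ℚ) [W.IsElliptic] [W.IsGloballyMinimal] (p : ℕ) [Fact p.Prime]
    (hX9 : ClassX9 W p) (hr : W.analyticRank = 1)
    -- the Howard frame
    (K : Type) [Field K] [NumberField K] (hK : IsImaginaryQuadratic K)
    (hodd : Odd (NumberField.discr K)) (hlt : NumberField.discr K < -4)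
    (hHN : SatisfiesHeegnerHypothesis (W.conductorNorm ℤ) K) (hHp : SatisfiesHeegnerHypothesis p K)
    (hhK : ¬ p ∣ NumberField.classNumber K)
    (hLt : (W.quadraticTwist (NumberField.discr K : ℚ)).entireLFunction 1 ≠ 0)
    -- the K6 typed rank-`0` engine
    (hIMC : IntegralMainConjectureOnClassX9) : BSDp W p := by
  obtain ⟨-, hp5, hgood, hord, hirr, -⟩ := id hX9
  have hpP : p.Prime := Fact.out
  have hp2 : p ≠ 2 := by omega
  haveI : NeZero (W.conductorNorm ℤ) := ⟨(W.conductorNorm_pos_holds).ne'⟩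
  -- `p ∤ d_K` and `w_K = 2`
  have hpd : ¬ (p : ℤ) ∣ NumberField.discr K := not_dvd_discr_of_split hK hpP hp2 hHp
  have hμ : ¬ p ∣ Units.torsionOrder K := by
    haveI : IsTotallyComplex K := hK.2
    rw [Literature.NumberTheory.DiophantineGeometry.torsionOrder_eq_two_of_discr_lt hK.1 hlt]
    intro hdvd
    have := Nat.le_of_dvd two_pos hdvd
    omega
  -- the Manin-unit Heegner datum at the good prime `p`
  obtain ⟨Dt, H, ι, P, hP, hc⟩ :=
    X11b.exists_maninDatum_of_good hnf hMaz hNS W p (W.conductorNorm ℤ) K rfl hp2 hgood hirr hK hHN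
  -- the identity over `K` from the Howard road (companion §3)
  have hid : Finite (W.baseChange K).sha → X11b.IndexIdentityAt W p K P := fun _ ↦
    X9.indexIdentityAt_of_heegner_of_cor46_of_thm331 W p K Dt H ι P h46 hYZ h331 (hGZ _ W K)
      (hKo _ W K) hmod hGZK (classX9_census_of_classX9 W p hX9) hr hK hodd hlt hHN hHp hhK hLt hP hc
  -- a globally minimal model of the twist (Néron), its X9 transports, its rank-`0` engine
  have hD0 : (NumberField.discr K : ℚ) ≠ 0 := by exact_mod_cast NumberField.discr_ne_zero K
  haveI hEt : (W.quadraticTwist (NumberField.discr K : ℚ)).IsElliptic :=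
    W.isElliptic_quadraticTwist hD0
  obtain ⟨Cd, hCd⟩ := hasGlobalMinimalModel_rat_holds (W.quadraticTwist (NumberField.discr K : ℚ))
  haveI : (Cd • W.quadraticTwist (NumberField.discr K : ℚ)).IsGloballyMinimal := hCd
  have hWd : Cd • W.quadraticTwist (NumberField.discr K : ℚ) =
      Cd • W.quadraticTwist (NumberField.discr K : ℚ) := rfl
  have hX9d : ClassX9 (Cd • W.quadraticTwist (NumberField.discr K : ℚ)) p :=
    classX9_twist_model hX9 K hK.1 hpd Cd hWd
  have hordd : GoodOrd (Cd • W.quadraticTwist (NumberField.discr K : ℚ)) p :=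
    ⟨hX9d.2.2.1, hX9d.2.2.2.1⟩
  have htam : padicValNat p (Cd • W.quadraticTwist (NumberField.discr K : ℚ)).tamagawaProduct =
      padicValNat p W.tamagawaProduct :=
    X2.padicValNat_tamagawaProduct_twist_of_heegner_of_odd W p hp2 K hK hodd hpd hHN Cd hWd
  have hu : padicValRat p (Cd.u : ℚ) = 0 :=
    X11b.padicValRat_u_eq_zero_of_twist_good W p hpd hgood Cd hWd hordd.1
  have hMCd : MazurMainConjecture (Cd • W.quadraticTwist (NumberField.discr K : ℚ)) p :=
    mazurMainConjecture_of_integralMainConjectureOnClassX9 h5 hIMC hX9d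
  exact X11b.bsdp_rankOne_of_indexIdentityAt_of_twist_mazurMainConjecture W p (W.conductorNorm ℤ) K Dt
    H ι P (hGZ _ W K) (hKo _ W K) hGr hGZK hmod hpar hr hp2 hK hHN hP hc hμ hLt
    (Cd • W.quadraticTwist (NumberField.discr K : ℚ)) Cd hWd hordd htam hu hMCd hid

/-! ### §2 The LEAF from the FRAME SUPPLY, Mastella–Zerman, the composite, the K6 engine and print — no J -/

/-- **`BSDpOnClassX9` ⟸ PUBLISHED named facts ∧ `IntegralMainConjectureOnClassX9` (K6 typed rank-`0`
engine) ∧ the FRAME SUPPLY `hFS` — the J-FREE assembly of the X9 Heegner road.** `hFS`: every X9 pair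
(census predicate) with `ord_{s=1} L(E,s) = 1` admits an imaginary quadratic field `K` with `d_K` odd
`< −4`, every `ℓ ∣ N_E` and `p` split, `p ∤ h_K` and `L(E^{d_K},1) ≠ 0` (Hoffstein–Luo 1997 gives all
of this EXCEPT `p ∤ h_K`; per pair a finite certificate). Rank `0`: the K6 engine at the pair (CGLS
5.1.4's chain, `bsdp_of_mazurMainConjecture_of_analyticRank_eq_zero`). Rank `1`: §1 at the supplied
frame. PUBLISHED binders: Mastella–Zerman 2026 Cor. 4.6 (`h46`), the Yan–Zhu 5.7 (1)/5.9 + BCS 4.2.2 +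
CGLS 5.1.3 composite (`hYZ`, flag `YZ26-57i+59+BCS422+CGLS513-composite`), JSW 2017 Thm. 3.3.1 (`h331`),
Gross–Zagier, Kolyvagin, Greenberg 4.1, GZK, modularity ×3, Mazur's Manin constant, Néron scaling, the
period unit. NOT used: crux J / `MultiPrimeX9`, Cha 2005 Rmk. 25, Matar–Nekovář's index bound,
Hoffstein–Luo. Nothing is booked: `hFS` and `hIMC` are OPEN.
[cite: MastellaZerman2026, Cor. 4.6] [cite: YanZhu2024MainConjNonCM, Thm. 5.7 (1), Thm. 5.9]
[cite: BurungaleCastellaSkinner2025, Prop. 4.2.2, Cor. 1.3.1 (proof, p. 4)]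
[cite: JetchevSkinnerWan2017, Thm. 3.3.1] [cite: Howard2004HeegnerKolyvagin, Thm. B, §3 (p ∤ h_K)]
[cite: Miller2011LMS, §1 and Def. 1.1] -/
theorem bsdpOnClassX9_of_heegnerFrameSupply_of_cor46_of_integralMainConjectureOnClassX9
    (h46 : MastellaZerman2026.cor46_howardDivisibility_of_scalarImage.{0})
    (hYZ : thm57_thm59_bcs422_cgls513_generator_constantCoeff_of_heegnerDivisibility)
    (h331 : thm331_anticyclotomicControl)
    (hGZ : ∀ (N : ℕ) [NeZero N] (W : WeierstrassCurve ℚ) (K : Type) [Field K] [NumberField K],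
      gross_zagier N W K)
    (hKo : ∀ (N : ℕ) [NeZero N] (W : WeierstrassCurve ℚ) (K : Type) [Field K] [NumberField K],
      kolyvagin N W K)
    (hGr : greenberg_charValue_rankZero) (hGZK : rank_eq_analyticRank_of_analyticRank_le_one)
    (hmod : hasEntireLFunction_rat) (hpar : nonempty_modularParametrizationData)
    (hnf : exists_isNewformOf)
    (hMaz : mazur_not_dvd_maninConstant_of_odd) (hNS : integral_neronScaling_of_isGloballyMinimal)
    (h5 : realPeriodRat_eq_unit_mul_plusPeriod)
    -- the FRAME SUPPLY (OPEN; Hoffstein–Luo + `p ∤ h_K`)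
    (hFS : ∀ (W : WeierstrassCurve ℚ) [W.IsElliptic] [W.IsGloballyMinimal] [NeZero (W.conductorNorm ℤ)]
      (p : ℕ) [Fact p.Prime], Literature.NumberTheory.EllipticCurves.Rank1Residual.ClassX9 W p →
      W.analyticRank = 1 →
      ∃ (K : Type) (_ : Field K) (_ : NumberField K), IsImaginaryQuadratic K ∧
        Odd (NumberField.discr K) ∧ NumberField.discr K < -4 ∧
        SatisfiesHeegnerHypothesis (W.conductorNorm ℤ) K ∧ SatisfiesHeegnerHypothesis p K ∧
        ¬ p ∣ NumberField.classNumber K ∧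
        (W.quadraticTwist (NumberField.discr K : ℚ)).entireLFunction 1 ≠ 0)
    -- the K6 typed rank-`0` engine
    (hIMC : IntegralMainConjectureOnClassX9) : BSDpOnClassX9 := by
  intro W _ _ p _ hran hX9 _
  obtain ⟨-, hp5, hgood, hord, -, -⟩ := id hX9
  have hbsdp : BSDp W p := by
    rcases Nat.lt_or_ge W.analyticRank 1 with h0 | h1
    · exact bsdp_of_mazurMainConjecture_of_analyticRank_eq_zero hGr hpar hGZK (by omega) ⟨hgood, hord⟩
        (by omega) (mazurMainConjecture_of_integralMainConjectureOnClassX9 h5 hIMC hX9)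
    · have hr : W.analyticRank = 1 := le_antisymm hran h1
      haveI : NeZero (W.conductorNorm ℤ) := ⟨(W.conductorNorm_pos_holds).ne'⟩
      obtain ⟨K, _, _, hK, hodd, hlt, hHN, hHp, hhK, hLt⟩ :=
        hFS W p (classX9_census_of_classX9 W p hX9) hr
      exact X9.bsdp_rankOne_of_howardFrame_of_x9IntegralMainConjecture h46 hYZ h331 hGZ hKo hGr hGZK
        hmod hpar hnf hMaz hNS h5 W p hX9 hr K hK hodd hlt hHN hHp hhK hLt hIMC
  exact (pPartBSD_iff_pPart W p).mpr (pPart_of_bsdp hmod hGZK W p hran hbsdp)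

/-- **The J-FREE Schneider-free ASSEMBLY of the X9 Heegner road from route `PrintX9`'s μ-items:
FRAME SUPPLY → `KatoMuTransfer` (= `MuTransfer`, 19629) → `AnalyticMuZeroOnClassX9` (= `AnalyticMuZeroX9`,
19630) → PUBLISHED facts → `BSDpOnClassX9`** (the K6 leaf; the W-ALL/9 corner follows by
`wallCornerX9_of_bsdpOnClassX9`). Compared with `bsdpOnClassX9_of_heegnerDivisibilityX9_of_katoMuTransfer`:
the crux `HeegnerDivisibilityX9` (20392; residual `MultiPrimeX9`) is NOT used; the Howard-side named
facts `h46` (PUB, flag-free) and `hYZ` (PUB composite) and the frame supply `hFS` are used instead.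
[cite: MastellaZerman2026, Cor. 4.6] [cite: BurungaleCastellaSkinner2025, Thm. 1.1.2 (a), Cor. 1.3.1]
[cite: Kato2004Asterisque, Thm. 12.5, 17.4] [cite: GreenbergLNM1716, Conj. 1.11, Thm. 4.1] -/
theorem bsdpOnClassX9_of_heegnerFrameSupply_of_cor46_of_katoMuTransfer
    (h46 : MastellaZerman2026.cor46_howardDivisibility_of_scalarImage.{0})
    (hYZ : thm57_thm59_bcs422_cgls513_generator_constantCoeff_of_heegnerDivisibility)
    (h331 : thm331_anticyclotomicControl)
    (hGZ : ∀ (N : ℕ) [NeZero N] (W : WeierstrassCurve ℚ) (K : Type) [Field K] [NumberField K],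
      gross_zagier N W K)
    (hKo : ∀ (N : ℕ) [NeZero N] (W : WeierstrassCurve ℚ) (K : Type) [Field K] [NumberField K],
      kolyvagin N W K)
    (hBCS : burungale_castella_skinner_charIdeal_eq_padicLFunction)
    (hGr : greenberg_charValue_rankZero) (hGZK : rank_eq_analyticRank_of_analyticRank_le_one)
    (hmod : hasEntireLFunction_rat) (hpar : nonempty_modularParametrizationData)
    (hnf : exists_isNewformOf)
    (hMaz : mazur_not_dvd_maninConstant_of_odd) (hNS : integral_neronScaling_of_isGloballyMinimal)
    (h5 : realPeriodRat_eq_unit_mul_plusPeriod)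
    (hFS : ∀ (W : WeierstrassCurve ℚ) [W.IsElliptic] [W.IsGloballyMinimal] [NeZero (W.conductorNorm ℤ)]
      (p : ℕ) [Fact p.Prime], Literature.NumberTheory.EllipticCurves.Rank1Residual.ClassX9 W p →
      W.analyticRank = 1 →
      ∃ (K : Type) (_ : Field K) (_ : NumberField K), IsImaginaryQuadratic K ∧
        Odd (NumberField.discr K) ∧ NumberField.discr K < -4 ∧
        SatisfiesHeegnerHypothesis (W.conductorNorm ℤ) K ∧ SatisfiesHeegnerHypothesis p K ∧
        ¬ p ∣ NumberField.classNumber K ∧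
        (W.quadraticTwist (NumberField.discr K : ℚ)).entireLFunction 1 ≠ 0)
    (h1 : KatoMuTransfer) (h2 : AnalyticMuZeroOnClassX9) : BSDpOnClassX9 :=
  bsdpOnClassX9_of_heegnerFrameSupply_of_cor46_of_integralMainConjectureOnClassX9 h46 hYZ h331 hGZ hKo
    hGr hGZK hmod hpar hnf hMaz hNS h5 hFS (integralMainConjectureOnClassX9_of_katoMuTransfer hBCS h1 h2)

end Summit.BirchSwinnertonDyer.BirchSwinnertonDyer.Rank1Residual

end
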